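import Summits.ABC.IUTFork.Joshi.InitialThetaDataJoshi
import Literature.IUT.HodgeTheaters.InitialThetaDataPlaces
import Literature.NumberTheory.DiophantineGeometry.LocalReductionFiniteBadPlacesProofs
import HarnessLib

/-!
# [J-III] §3.2 (6)–(8), §3.4: the sets `V^{odd,ss}` are FINITE — proved for Joshi's typed data

Proof-only companion (theorems only; no definition, no named fact, no instance) of `Joshi/InitialThetaDataJoshi.lean`
(abc-iut-E-t6, p428841), rung LADDER-ABC:A2.E. TAKES NO SIDE on [IUTchIII] Cor. 3.12 or on any author; typed ≠ proved.
[J-III] = K. Joshi, arXiv:2401.13508v4. The consumers of the §3 data quantify over `w ∈ V^{odd,ss}` as a FINITE product/sum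
(Thm. 7.3.1 proof p.55 l.13–16, Thm. 9.11.1 p.127 «`∏_{w ∈ 𝕍^{odd,ss}}`»; E-t4's `FundamentalEstimateSetting.W : Finset (Val L')`
with `W ⊆ D.Voddss`, `ATS3FundamentalEstimateStatement.lean`); print takes finiteness for granted. Here it is PROVED from the
tree: an elliptic curve over a number field has good reduction outside a finite set of places (Silverman AEC VII.5 / VIII.1
Rmk. 1.3 = the tree's `WeierstrassCurve.finite_badPlaces_holds`, `LocalReductionFiniteBadPlacesProofs`), and multiplicative
places are bad places. Results: `voddss_finite` (`ATS3.Voddss C M`, any number field `M ⊇ L`), `voddssMod_finite`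
(`ATS3.VoddssMod C`: every prime of `L_mod` has a prime of `L` above it — the tree's `Val.restrict_surjective` — which is then a
multiplicative, hence bad, place), `voddSplitMod_finite`, and for the datum `D` the §3.4 sets: `InitialThetaData.voddss_finite`
(`V^{odd,ss} = V ∩ V^{odd,ss}_{L'}`), `voddssP_finite`. So E-t4's `W` may be taken to be ALL of `V^{odd,ss}`
(`D.voddss_finite.toFinset`), as print intends. [claim: Joshi2024ATS3, status: disputed]
-/

noncomputable section

open scoped Classical
open NumberField IsDedekindDomain
open Literature.IUT.HodgeTheaters hiding InitialThetaData

universe u v w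

namespace Summit.ABC.IUTFork.Joshi.ATS3

section Curve

variable {L : Type u} [Field L] [NumberField L] (C : WeierstrassCurve L) [C.IsElliptic]

omit [NumberField L] in
/-- **`V^{odd,ss}_M` is finite** for every number field `M ⊇ L` ([J-III] §3.2 (8)): its members are places of multiplicative,
hence bad, reduction of `C_M`, and an elliptic curve has only finitely many bad places (tree `finite_badPlaces_holds`). PROVED.
[folklore] -/
theorem voddss_finite (M : Type v) [Field M] [NumberField M] [Algebra L M] : (Voddss C M).Finite := by
  haveI : (C.baseChange M).IsElliptic := inferInstanceAs (C.map (algebraMap L M)).IsElliptic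
  have hbad : ((C.baseChange M).badPlaces (𝓞 M)).Finite := (C.baseChange M).finite_badPlaces_holds (𝓞 M)
  have hpre : (FinitePlace.maximalIdeal ⁻¹' (C.baseChange M).badPlaces (𝓞 M) : Set (FinitePlace M)).Finite :=
    hbad.preimage (FinitePlace.maximalIdeal_injective (K := M)).injOn
  refine hpre.subset fun w hw => ?_
  rw [Set.mem_preimage, WeierstrassCurve.mem_badPlaces_iff]
  exact hw.2.not_hasGoodReductionAt

/-- **`V^{odd,ss}_{L_mod}` is finite** ([J-III] §3.2 (6), multiplicative reading): every prime `w` of `L_mod` lies under some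
finite place `v` of `L` (tree `Val.restrict_surjective`), which for `w ∈ V^{odd,ss}_{L_mod}` is a multiplicative — hence bad —
place of `C`; so `V^{odd,ss}_{L_mod}` is contained in the image of the finite set of bad places of `C`. PROVED. [folklore] -/
theorem voddssMod_finite : (VoddssMod C).Finite := by
  have hbad : (C.badPlaces (𝓞 L)).Finite := C.finite_badPlaces_holds (𝓞 L)
  -- the restriction of finite places `V(L)^non → V(L_mod)^non`
  let g : FinitePlace L → FinitePlace (fieldOfModuli C) :=
    fun v => FinitePlace.mk ((FinitePlace.maximalIdeal v).under (𝓞 (fieldOfModuli C)))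
  have hB : {v : FinitePlace L | ¬ C.HasGoodReductionAt v.maximalIdeal}.Finite :=
    (hbad.preimage (FinitePlace.maximalIdeal_injective (K := L)).injOn).subset fun v hv => by
      rw [Set.mem_preimage, WeierstrassCurve.mem_badPlaces_iff]; exact hv
  refine (hB.image g).subset fun w hw => ?_
  -- a finite place of `L` above `w`
  obtain ⟨u, hu⟩ := Val.restrict_surjective (fieldOfModuli C) (M := L) (Val.non w)
  rcases u with u | v
  · -- an archimedean place restricts to an archimedean place
    exact absurd hu (by simp [Val.restrict, Val.non])
  · have hv : LiesOverMod C v w := hu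
    refine ⟨v, (hw.2 v hv).not_hasGoodReductionAt, ?_⟩
    -- `g v = w` is the finite component of `Val.restrict (Val.non v) = Val.non w`
    have := hu
    simp only [Val.restrict, Val.non, Sum.map_inr] at this
    exact Sum.inr_injective this

/-- `V^{odd,ss}_{L_mod}` in the split-multiplicative gloss of (6) is finite (a subset of the multiplicative reading). PROVED.
[folklore] -/
theorem voddSplitMod_finite : (VoddSplitMod C).Finite := (voddssMod_finite C).subset (voddSplitMod_subset C)

end Curve

namespace InitialThetaData

variable {L : Type u} {L' : Type v} {Lbar : Type w} [Field L] [NumberField L] [Field L'] [NumberField L']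
  [Algebra L L'] [Field Lbar] [Algebra L Lbar] [Algebra L' Lbar] {C : WeierstrassCurve L} [C.IsElliptic]
  {ℓ : ℕ} (D : InitialThetaData L L' Lbar C ℓ)

/-- **`V^{odd,ss} = V ∩ V^{odd,ss}_{L'}` is finite** ([J-III] §3.4 p.28 l.31–33; the index set of `∏_{w ∈ 𝕍^{odd,ss}}` in Thm. 7.3.1 /
Thm. 9.11.1): it lies in the image of the finite set `V^{odd,ss}_{L'}` under `Val.non`. PROVED — so E-t4's
`FundamentalEstimateSetting.W` may be taken to be `D.voddss_finite.toFinset`, the whole of `𝕍^{odd,ss}`. [claim: Joshi2024ATS3, status: disputed] -/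
theorem voddss_finite : D.Voddss.Finite := by
  refine ((ATS3.voddss_finite C L').image Val.non).subset ?_
  rintro w ⟨-, w₀, rfl, h₀⟩
  exact ⟨w₀, h₀, rfl⟩

/-- `V^{odd,ss}_p = {w ∈ V^{odd,ss} : w | p}` is finite ([J-III] §3.4 p.29 l.6–8). PROVED. [claim: Joshi2024ATS3, status: disputed] -/
theorem voddssP_finite (p : ℕ) : (D.VoddssP p).Finite := D.voddss_finite.subset Set.inter_subset_left

/-- Membership in the finite index set: `w ∈ D.voddss_finite.toFinset ↔ w ∈ V^{odd,ss}`. [folklore] -/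
theorem mem_voddss_toFinset (w : Val L') : w ∈ D.voddss_finite.toFinset ↔ w ∈ D.Voddss :=
  Set.Finite.mem_toFinset _

/-- The full index set qualifies as E-t4's `W`: `↑(D.voddss_finite.toFinset) ⊆ D.Voddss` (indeed `=`). [folklore] -/
theorem coe_voddss_toFinset : (↑D.voddss_finite.toFinset : Set (Val L')) = D.Voddss := Set.Finite.coe_toFinset _

end InitialThetaData

end Summit.ABC.IUTFork.Joshi.ATS3

end
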